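import Literature.NumberTheory.Sieve.DrappeauDispersionR1ppInner
import HarnessLib

/-!
# Drappeau 2017, §5.5: the blocked pieces of `ℛ₁''` ARE left-hand sides of Theorem 2.1

Topic `Literature/NumberTheory/Sieve`, part of the formalisation of §5 of S. Drappeau, Proc. London
Math. Soc. (3) 114 (2017) 684–732 = arXiv:1504.05549, p. 20–21.  Conclusion of the reindexing:
for divisors `δ₁, δ₂` and classes `λ₁, λ₂` coprime to `m = |a₂|n₀`, a sign block and a weight `G`
agreeing with the five-variable weight `g` on the relevant plateau, the blocked piece sum of `ℛ₁''`
(positive block), resp. its complex conjugate (negative block), equals the quintilinear sum of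
Theorem 2.1 with modulus `𝐪 = m`, classes `c₀ = λ₂δ₂⁻¹`, `d₀ = λ₁δ₁⁻¹`, coefficients
`bCoef` resp. `bGen … (conj ∘ value)`, and weight `g`.  Everything proved (no definition, no fact).

* `sum_sum_eq_of_support` — range reconciliation;
* `collInner_support` — where the collapsed inner sums can be non-zero;
* `pieceSumBlk_eq_cruxLHS_pos`, `conj_pieceSumBlk_eq_cruxLHS_neg` — the identifications.

## References

* S. Drappeau, Proc. London Math. Soc. (3) 114 (2017) 684–732, arXiv:1504.05549, §5.5 p. 20–21,
  Theorem 2.1. [cite: Drappeau2017, §5.5]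
-/

noncomputable section

open Finset Real Complex
open scoped ArithmeticFunction.Moebius FourierTransform

namespace Literature.NumberTheory.Sieve

namespace Drappeau2017

/-- **Range reconciliation**: two double sums of the same function agree when the function is
supported inside both index rectangles. [folklore] -/
theorem sum_sum_eq_of_support (s₁ s₂ t₁ t₂ : Finset ℕ) (Ψ : ℕ → ℕ → ℂ)
    (hΨ : ∀ c d, Ψ c d ≠ 0 → (c ∈ s₁ ∧ c ∈ s₂) ∧ (d ∈ t₁ ∧ d ∈ t₂)) :
    ∑ c ∈ s₁, ∑ d ∈ t₁, Ψ c d = ∑ c ∈ s₂, ∑ d ∈ t₂, Ψ c d := by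
  have key : ∀ (s t : Finset ℕ), (∀ c d, Ψ c d ≠ 0 → c ∈ s ∧ d ∈ t) → s ⊆ s₁ ∪ s₂ →
      t ⊆ t₁ ∪ t₂ → ∑ c ∈ s, ∑ d ∈ t, Ψ c d = ∑ c ∈ s₁ ∪ s₂, ∑ d ∈ t₁ ∪ t₂, Ψ c d := by
    intro s t hst hs ht
    have inner : ∀ c, ∑ d ∈ t, Ψ c d = ∑ d ∈ t₁ ∪ t₂, Ψ c d := by
      intro c
      apply Finset.sum_subset ht
      intro d _ hd
      by_contra h
      exact hd (hst c d h).2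
    rw [Finset.sum_congr rfl fun c _ => inner c]
    apply Finset.sum_subset hs
    intro c _ hc
    refine Finset.sum_eq_zero fun d _ => ?_
    by_contra h
    exact hc (hst c d h).1
  rw [key s₁ t₁ (fun c d h => ⟨(hΨ c d h).1.1, (hΨ c d h).2.1⟩) Finset.subset_union_left
      Finset.subset_union_left,
    key s₂ t₂ (fun c d h => ⟨(hΨ c d h).1.2, (hΨ c d h).2.2⟩) Finset.subset_union_right
      Finset.subset_union_right]

section Main

/-- **Support of the collapsed inner sums.**  If the inner sum at `(𝐜, 𝐝)` is non-zero then `𝐜, 𝐝`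
lie both in the boxes of Theorem 2.1 and in the (reduced, divided) moduli sets of `ℛ₁''`.
[cite: Drappeau2017, §5.5 p. 20–21] -/
theorem collInner_support {S Y N : ℝ} (hN : 0 ≤ N) {a₁ a₂ : ℤ} (ha₂ : a₂ ≠ 0) {q₀ n₀ : ℕ}
    (hq₀ : 0 < q₀) (hn₀ : 0 < n₀) (hq₀a₂ : IsCoprime (q₀ : ℤ) a₂)
    {l₁ l₂ : ℕ} (hl₁ : Nat.Coprime l₁ (a₂.natAbs * n₀)) (hl₂ : Nat.Coprime l₂ (a₂.natAbs * n₀))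
    (hl₁lt : l₁ < a₂.natAbs * n₀) (hl₂lt : l₂ < a₂.natAbs * n₀)
    {δ₁ δ₂ : ℕ} (hδ₁ : 0 < δ₁) (hδ₂ : 0 < δ₂) {c₀ d₀ : ℕ}
    (hc₀ : δ₂ * c₀ ≡ l₂ [MOD a₂.natAbs * n₀]) (hd₀ : δ₁ * d₀ ≡ l₁ [MOD a₂.natAbs * n₀])
    (H nlo nhi Cn Dn : ℕ) {In Ir Is : Finset ℕ}
    {g : ℝ → ℝ → ℝ → ℝ → ℝ → ℂ}
    (hgsupp : ∀ c d : ℕ, ∀ n r s : ℝ, g c d n r s ≠ 0 →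
      (1 ≤ c ∧ c ≤ Cn ∧ 1 ≤ d ∧ d ≤ Dn) ∧ q₀ * (δ₂ * c) ∈ BFI.mRange S Y ∧
        q₀ * (δ₁ * d) ∈ BFI.mRange S Y)
    (σ : ℤ) (V : ℤ → ℕ → ℕ → ℂ) (c d : ℕ)
    (h : ∑ n₁ ∈ ((((BFI.dyadic N).filter (fun n : ℕ => IsCoprime (n : ℤ) a₂)).filter (fun n : ℕ => n₀ ∣ n)).image (fun n : ℕ => n / n₀)), ∑ n₂ ∈ ((((BFI.dyadic N).filter (fun n : ℕ => IsCoprime (n : ℤ) a₂)).filter (fun n : ℕ => n₀ ∣ n)).image (fun n : ℕ => n / n₀)), ∑ h ∈ (Finset.Icc (-(H : ℤ)) H).filter (fun h : ℤ => h ≠ 0),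
          (if (0 ≤ nVar σ a₁ a₂ q₀ h n₁ n₂ ∧ (nVar σ a₁ a₂ q₀ h n₁ n₂).toNat ∈ In ∧ (a₂.natAbs * n₀ * δ₁ * n₂) ∈ Ir ∧ (δ₂ * n₁) ∈ Is ∧
          (c ≡ c₀ [MOD a₂.natAbs * n₀] ∧ d ≡ d₀ [MOD a₂.natAbs * n₀] ∧ Nat.Coprime (a₂.natAbs * n₀ * (a₂.natAbs * n₀ * δ₁ * n₂) * d) ((δ₂ * n₁) * c)) ∧
          (Nat.Coprime n₁ n₂ ∧ n₁ ≡ n₂ [MOD q₀] ∧ (n₀ * n₁).Coprime q₀ ∧ (n₀ * n₂).Coprime q₀ ∧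
            ((nlo : ℕ) : ℤ) ≤ nVar σ a₁ a₂ q₀ h n₁ n₂ ∧ nVar σ a₁ a₂ q₀ h n₁ n₂ < ((nhi : ℕ) : ℤ))) then
            V h n₁ n₂ *
            (g c d (nVar σ a₁ a₂ q₀ h n₁ n₂).toNat ((a₂.natAbs * n₀ * δ₁ * n₂ : ℕ) : ℝ) ((δ₂ * n₁ : ℕ) : ℝ) *
              (𝐞 (((nVar σ a₁ a₂ q₀ h n₁ n₂).toNat : ℝ) * (((((a₂.natAbs * n₀ * δ₁ * n₂) * d : ℕ) : ZMod ((δ₂ * n₁) * c))⁻¹).val : ℝ) /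
                (((δ₂ * n₁ : ℕ) : ℝ) * c)) : ℂ))
          else 0) ≠ 0) :
    (c ∈ ((((((((BFI.mRange S Y).filter (fun q : ℕ => 0 < q)).filter (fun q : ℕ => IsCoprime (q : ℤ) a₂)).filter (fun q : ℕ => q₀ ∣ q)).image (fun q : ℕ => q / q₀)).filter (fun q : ℕ => q % (a₂.natAbs * n₀) = l₂)).filter (fun q : ℕ => δ₂ ∣ q)).image (fun q : ℕ => q / δ₂)) ∧ c ∈ Finset.Icc 1 Cn) ∧ (d ∈ ((((((((BFI.mRange S Y).filter (fun q : ℕ => 0 < q)).filter (fun q : ℕ => IsCoprime (q : ℤ) a₂)).filter (fun q : ℕ => q₀ ∣ q)).image (fun q : ℕ => q / q₀)).filter (fun q : ℕ => q % (a₂.natAbs * n₀) = l₁)).filter (fun q : ℕ => δ₁ ∣ q)).image (fun q : ℕ => q / δ₁)) ∧ d ∈ Finset.Icc 1 Dn) := by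
  have _ := hN
  obtain ⟨⟨hcc, hdc⟩, n, r, s, hg⟩ := exists_of_collInner_ne_zero σ V h
  obtain ⟨⟨hc1, hcC, hd1, hdD⟩, hcR, hdR⟩ := hgsupp c d n r s hg
  have hmpos : 0 < a₂.natAbs * n₀ := Nat.mul_pos (Int.natAbs_pos.2 ha₂) hn₀
  -- classes of `δ₂ c`, `δ₁ d`
  have hc' : δ₂ * c ≡ l₂ [MOD a₂.natAbs * n₀] := (Nat.ModEq.mul_left δ₂ hcc).trans hc₀
  have hd' : δ₁ * d ≡ l₁ [MOD a₂.natAbs * n₀] := (Nat.ModEq.mul_left δ₁ hdc).trans hd₀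
  have hcmod : (δ₂ * c) % (a₂.natAbs * n₀) = l₂ := by
    have := hc'; unfold Nat.ModEq at this; rw [this, Nat.mod_eq_of_lt hl₂lt]
  have hdmod : (δ₁ * d) % (a₂.natAbs * n₀) = l₁ := by
    have := hd'; unfold Nat.ModEq at this; rw [this, Nat.mod_eq_of_lt hl₁lt]
  -- coprimality with `a₂`
  have hccop : Nat.Coprime (δ₂ * c) (a₂.natAbs * n₀) := by
    unfold Nat.Coprime; rw [hc'.gcd_eq]; exact hl₂
  have hdcop : Nat.Coprime (δ₁ * d) (a₂.natAbs * n₀) := by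
    unfold Nat.Coprime; rw [hd'.gcd_eq]; exact hl₁
  have hcZ : IsCoprime ((q₀ * (δ₂ * c) : ℕ) : ℤ) a₂ := by
    push_cast
    exact hq₀a₂.mul_left ((isCoprime_natCast_left_iff _ _).2
      (by exact_mod_cast hccop.coprime_mul_right_right))
  have hdZ : IsCoprime ((q₀ * (δ₁ * d) : ℕ) : ℤ) a₂ := by
    push_cast
    exact hq₀a₂.mul_left ((isCoprime_natCast_left_iff _ _).2
      (by exact_mod_cast hdcop.coprime_mul_right_right))
  refine ⟨⟨moduliImage_mem hq₀ hδ₂ hc1 hcmod hcR hcZ, Finset.mem_Icc.2 ⟨hc1, hcC⟩⟩,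
    ⟨moduliImage_mem hq₀ hδ₁ hd1 hdmod hdR hdZ, Finset.mem_Icc.2 ⟨hd1, hdD⟩⟩⟩

/-- Facts about an element of the divided moduli set. [folklore] -/
theorem moduli_facts {S Y : ℝ} {a₂ : ℤ} {q₀ n₀ : ℕ} (hq₀ : 0 < q₀)
    {l : ℕ} (hl : Nat.Coprime l (a₂.natAbs * n₀)) (hllt : l < a₂.natAbs * n₀) {δ : ℕ} (hδ : 0 < δ)
    (hδm : Nat.Coprime δ (a₂.natAbs * n₀)) {e₀ : ℕ} (he₀ : δ * e₀ ≡ l [MOD a₂.natAbs * n₀]) {c : ℕ}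
    (hc : c ∈ ((((((((BFI.mRange S Y).filter (fun q : ℕ => 0 < q)).filter (fun q : ℕ => IsCoprime (q : ℤ) a₂)).filter (fun q : ℕ => q₀ ∣ q)).image (fun q : ℕ => q / q₀)).filter (fun q : ℕ => q % (a₂.natAbs * n₀) = l)).filter
      (fun q : ℕ => δ ∣ q)).image (fun q : ℕ => q / δ))) :
    0 < c ∧ Nat.Coprime c (a₂.natAbs * n₀) ∧ c ≡ e₀ [MOD a₂.natAbs * n₀] := by
  obtain ⟨hc0, hcmod⟩ := mem_moduliImage hq₀ hδ hc
  have hc' : δ * c ≡ l [MOD a₂.natAbs * n₀] := by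
    unfold Nat.ModEq; rw [hcmod, Nat.mod_eq_of_lt hllt]
  refine ⟨hc0, ?_, ?_⟩
  · have h1 : Nat.Coprime (δ * c) (a₂.natAbs * n₀) := by
      unfold Nat.Coprime; rw [hc'.gcd_eq]; exact hl
    exact h1.coprime_mul_left
  · exact Nat.ModEq.cancel_left_of_coprime (c := δ) hδm.symm (hc'.trans he₀.symm)


/-- **The positive block of a piece of `ℛ₁''` is a left-hand side of Theorem 2.1.**
[cite: Drappeau2017, §5.5 p. 20–21, Theorem 2.1] -/
theorem pieceSumBlk_eq_cruxLHS_pos {S Y N : ℝ} (hN : 0 ≤ N) {a₁ a₂ : ℤ} (ha₂ : a₂ ≠ 0) {q₀ n₀ : ℕ}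
    (hq₀ : 0 < q₀) (hn₀ : 0 < n₀) (hq₀n₀ : Nat.Coprime q₀ n₀) (hq₀a₂ : IsCoprime (q₀ : ℤ) a₂)
    {l₁ l₂ : ℕ} (hl₁ : Nat.Coprime l₁ (a₂.natAbs * n₀)) (hl₂ : Nat.Coprime l₂ (a₂.natAbs * n₀))
    (hl₁lt : l₁ < a₂.natAbs * n₀) (hl₂lt : l₂ < a₂.natAbs * n₀)
    {δ₁ δ₂ : ℕ} (hδ₁ : 0 < δ₁) (hδ₂ : 0 < δ₂) (hδ₁m : Nat.Coprime δ₁ (a₂.natAbs * n₀))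
    (hδ₂m : Nat.Coprime δ₂ (a₂.natAbs * n₀)) {c₀ d₀ : ℕ}
    (hc₀ : δ₂ * c₀ ≡ l₂ [MOD a₂.natAbs * n₀]) (hd₀ : δ₁ * d₀ ≡ l₁ [MOD a₂.natAbs * n₀])
    {β : ℕ → ℂ} (hβ : ∀ n, ¬Squarefree n → β n = 0) (ξ : ℝ) (H nlo nhi Cn Dn : ℕ)
    {In Ir Is : Finset ℕ}
    (hIn : ∀ z : ℤ, ((nlo : ℕ) : ℤ) ≤ z → z < ((nhi : ℕ) : ℤ) → z.toNat ∈ In)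
    (hIr : ∀ n₂ ∈ ((((BFI.dyadic N).filter (fun n : ℕ => IsCoprime (n : ℤ) a₂)).filter (fun n : ℕ => n₀ ∣ n)).image (fun n : ℕ => n / n₀)), a₂.natAbs * n₀ * δ₁ * n₂ ∈ Ir)
    (hIs : ∀ n₁ ∈ ((((BFI.dyadic N).filter (fun n : ℕ => IsCoprime (n : ℤ) a₂)).filter (fun n : ℕ => n₀ ∣ n)).image (fun n : ℕ => n / n₀)), δ₂ * n₁ ∈ Is)
    {G : ℕ → ℕ → ℂ} {g : ℝ → ℝ → ℝ → ℝ → ℝ → ℂ}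
    (hgsupp : ∀ c d : ℕ, ∀ n r s : ℝ, g c d n r s ≠ 0 →
      (1 ≤ c ∧ c ≤ Cn ∧ 1 ≤ d ∧ d ≤ Dn) ∧ q₀ * (δ₂ * c) ∈ BFI.mRange S Y ∧
        q₀ * (δ₁ * d) ∈ BFI.mRange S Y)
    (hGg : ∀ c d : ℕ, ∀ n₁ ∈ ((((BFI.dyadic N).filter (fun n : ℕ => IsCoprime (n : ℤ) a₂)).filter (fun n : ℕ => n₀ ∣ n)).image (fun n : ℕ => n / n₀)), ∀ n₂ ∈ ((((BFI.dyadic N).filter (fun n : ℕ => IsCoprime (n : ℤ) a₂)).filter (fun n : ℕ => n₀ ∣ n)).image (fun n : ℕ => n / n₀)), ∀ h : ℤ,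
      ((nlo : ℕ) : ℤ) ≤ nVar 1 a₁ a₂ q₀ h n₁ n₂ → nVar 1 a₁ a₂ q₀ h n₁ n₂ < ((nhi : ℕ) : ℤ) →
      G (δ₁ * d) (δ₂ * c) = g c d (nVar 1 a₁ a₂ q₀ h n₁ n₂).toNat ((a₂.natAbs * n₀ * δ₁ * n₂ : ℕ) : ℝ) ((δ₂ * n₁ : ℕ) : ℝ)) :
    pieceSumBlk a₁ a₂ (((((((BFI.mRange S Y).filter (fun q : ℕ => 0 < q)).filter (fun q : ℕ => IsCoprime (q : ℤ) a₂)).filter (fun q : ℕ => q₀ ∣ q)).image (fun q : ℕ => q / q₀)).filter (fun q : ℕ => q % (a₂.natAbs * n₀) = l₁)).filter (fun q : ℕ => δ₁ ∣ q))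
        (((((((BFI.mRange S Y).filter (fun q : ℕ => 0 < q)).filter (fun q : ℕ => IsCoprime (q : ℤ) a₂)).filter (fun q : ℕ => q₀ ∣ q)).image (fun q : ℕ => q / q₀)).filter (fun q : ℕ => q % (a₂.natAbs * n₀) = l₂)).filter (fun q : ℕ => δ₂ ∣ q)) ((((BFI.dyadic N).filter (fun n : ℕ => IsCoprime (n : ℤ) a₂)).filter (fun n : ℕ => n₀ ∣ n)).image (fun n : ℕ => n / n₀))
        q₀ n₀ l₁ l₂ β ξ G H 1 nlo nhi =
      ∑ c ∈ Finset.Icc 1 Cn, ∑ d ∈ Finset.Icc 1 Dn, ∑ n ∈ In, ∑ r ∈ Ir, ∑ s ∈ Is,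
        (if (c ≡ c₀ [MOD a₂.natAbs * n₀] ∧ d ≡ d₀ [MOD a₂.natAbs * n₀] ∧
            Nat.Coprime (a₂.natAbs * n₀ * r * d) (s * c)) then
          bCoef a₁ a₂ ((((BFI.dyadic N).filter (fun n : ℕ => IsCoprime (n : ℤ) a₂)).filter (fun n : ℕ => n₀ ∣ n)).image (fun n : ℕ => n / n₀)) q₀ n₀ l₁ l₂ β ξ H 1 nlo nhi δ₁ δ₂ n r s * g c d n r s *
            (𝐞 ((n : ℝ) * ((((r * d : ℕ) : ZMod (s * c))⁻¹).val : ℝ) / ((s : ℝ) * c)) : ℂ)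
        else 0) := by
  -- the right-hand side, collapsed
  have hre : ∑ c ∈ Finset.Icc 1 Cn, ∑ d ∈ Finset.Icc 1 Dn, ∑ n ∈ In, ∑ r ∈ Ir, ∑ s ∈ Is,
        (if (c ≡ c₀ [MOD a₂.natAbs * n₀] ∧ d ≡ d₀ [MOD a₂.natAbs * n₀] ∧
            Nat.Coprime (a₂.natAbs * n₀ * r * d) (s * c)) then
          bCoef a₁ a₂ ((((BFI.dyadic N).filter (fun n : ℕ => IsCoprime (n : ℤ) a₂)).filter (fun n : ℕ => n₀ ∣ n)).image (fun n : ℕ => n / n₀)) q₀ n₀ l₁ l₂ β ξ H 1 nlo nhi δ₁ δ₂ n r s * g c d n r s *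
            (𝐞 ((n : ℝ) * ((((r * d : ℕ) : ZMod (s * c))⁻¹).val : ℝ) / ((s : ℝ) * c)) : ℂ)
        else 0) =
      ∑ c ∈ Finset.Icc 1 Cn, ∑ d ∈ Finset.Icc 1 Dn, ∑ n ∈ In, ∑ r ∈ Ir, ∑ s ∈ Is,
        (if (c ≡ c₀ [MOD a₂.natAbs * n₀] ∧ d ≡ d₀ [MOD a₂.natAbs * n₀] ∧
            Nat.Coprime (a₂.natAbs * n₀ * r * d) (s * c)) then
          bGen a₁ a₂ ((((BFI.dyadic N).filter (fun n : ℕ => IsCoprime (n : ℤ) a₂)).filter (fun n : ℕ => n₀ ∣ n)).image (fun n : ℕ => n / n₀)) q₀ n₀ H 1 nlo nhi δ₁ δ₂ (fun h n₁ n₂ => (β (n₀ * n₁) * starRingEnd ℂ (β (n₀ * n₂)) *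
              ((𝐞 (-(ξ * h)) : ℂ) *
                (𝐞 (-((h : ℝ) * a₁ *
                    ((((((q₀ : ℤ) * l₁ * l₂ * n₁ : ℤ) : ZMod (a₂.natAbs * n₀))⁻¹).val : ℕ) : ℝ) /
                      ((a₂ : ℝ) * n₀))) : ℂ)))) n r s *
            (fun c d n r s : ℕ => g c d n r s *
              (𝐞 ((n : ℝ) * ((((r * d : ℕ) : ZMod (s * c))⁻¹).val : ℝ) / ((s : ℝ) * c)) : ℂ))
              c d n r s
        else 0) := by
    refine Finset.sum_congr rfl fun c _ => Finset.sum_congr rfl fun d _ =>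
      Finset.sum_congr rfl fun n _ => Finset.sum_congr rfl fun r _ =>
      Finset.sum_congr rfl fun s _ => ?_
    rw [bCoef_eq_bGen]
    split_ifs
    · exact mul_assoc _ _ _
    · rfl
  rw [hre, cruxSum_bGen_eq]
  -- the left-hand side, re-indexed
  rw [pieceSumBlk_reindex, Finset.sum_comm]
  have hB : ∀ n ∈ ((((BFI.dyadic N).filter (fun n : ℕ => IsCoprime (n : ℤ) a₂)).filter (fun n : ℕ => n₀ ∣ n)).image (fun n : ℕ => n / n₀)), 0 < n ∧ Nat.Coprime (n₀ * n) a₂.natAbs :=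
    fun n hn => ⟨(mem_Bset hN hn₀ hn).1, (mem_Bset hN hn₀ hn).2.1⟩
  have hleft : ∀ c ∈ ((((((((BFI.mRange S Y).filter (fun q : ℕ => 0 < q)).filter (fun q : ℕ => IsCoprime (q : ℤ) a₂)).filter (fun q : ℕ => q₀ ∣ q)).image (fun q : ℕ => q / q₀)).filter (fun q : ℕ => q % (a₂.natAbs * n₀) = l₂)).filter (fun q : ℕ => δ₂ ∣ q)).image (fun q : ℕ => q / δ₂)), ∀ d ∈ ((((((((BFI.mRange S Y).filter (fun q : ℕ => 0 < q)).filter (fun q : ℕ => IsCoprime (q : ℤ) a₂)).filter (fun q : ℕ => q₀ ∣ q)).image (fun q : ℕ => q / q₀)).filter (fun q : ℕ => q % (a₂.natAbs * n₀) = l₁)).filter (fun q : ℕ => δ₁ ∣ q)).image (fun q : ℕ => q / δ₁)),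
      ∑ n₁ ∈ ((((BFI.dyadic N).filter (fun n : ℕ => IsCoprime (n : ℤ) a₂)).filter (fun n : ℕ => n₀ ∣ n)).image (fun n : ℕ => n / n₀)), ∑ n₂ ∈ ((((BFI.dyadic N).filter (fun n : ℕ => IsCoprime (n : ℤ) a₂)).filter (fun n : ℕ => n₀ ∣ n)).image (fun n : ℕ => n / n₀)), ∑ h ∈ (Finset.Icc (-(H : ℤ)) H).filter (fun h : ℤ => h ≠ 0),
          (if ((Nat.Coprime (δ₁ * d) (δ₂ * c) ∧ Nat.Coprime n₁ n₂ ∧ ((n₀ * n₁).Coprime (q₀ * (δ₁ * d)) ∧ (n₀ * n₂).Coprime (q₀ * (δ₂ * c)) ∧ n₁ ≡ n₂ [MOD q₀])) ∧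
          (((nlo : ℕ) : ℤ) ≤ nVar 1 a₁ a₂ q₀ h n₁ n₂ ∧ nVar 1 a₁ a₂ q₀ h n₁ n₂ < ((nhi : ℕ) : ℤ))) then
            G (δ₁ * d) (δ₂ * c) * (β (n₀ * n₁) * starRingEnd ℂ (β (n₀ * n₂))) *
              ((𝐞 (-(ξ * h)) : ℂ) *
                ((𝐞 ((h : ℝ) * a₁ * ((((n₁ : ℤ) - n₂) / q₀ : ℤ)) *
                    (((((((δ₁ * d : ℕ) : ℤ) * a₂ * n₀ * n₂ : ℤ) : ZMod (n₁ * (δ₂ * c)))⁻¹).val : ℕ) : ℝ) /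
                      ((n₁ : ℝ) * ((δ₂ * c : ℕ) : ℝ))) : ℂ) *
                  (𝐞 (-((h : ℝ) * a₁ *
                    ((((((q₀ : ℤ) * l₁ * l₂ * n₁ : ℤ) : ZMod (a₂.natAbs * n₀))⁻¹).val : ℕ) : ℝ) /
                      ((a₂ : ℝ) * n₀))) : ℂ)))
      else 0) = ∑ n₁ ∈ ((((BFI.dyadic N).filter (fun n : ℕ => IsCoprime (n : ℤ) a₂)).filter (fun n : ℕ => n₀ ∣ n)).image (fun n : ℕ => n / n₀)), ∑ n₂ ∈ ((((BFI.dyadic N).filter (fun n : ℕ => IsCoprime (n : ℤ) a₂)).filter (fun n : ℕ => n₀ ∣ n)).image (fun n : ℕ => n / n₀)), ∑ h ∈ (Finset.Icc (-(H : ℤ)) H).filter (fun h : ℤ => h ≠ 0),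
          (if (0 ≤ nVar 1 a₁ a₂ q₀ h n₁ n₂ ∧ (nVar 1 a₁ a₂ q₀ h n₁ n₂).toNat ∈ In ∧ (a₂.natAbs * n₀ * δ₁ * n₂) ∈ Ir ∧ (δ₂ * n₁) ∈ Is ∧
          (c ≡ c₀ [MOD a₂.natAbs * n₀] ∧ d ≡ d₀ [MOD a₂.natAbs * n₀] ∧ Nat.Coprime (a₂.natAbs * n₀ * (a₂.natAbs * n₀ * δ₁ * n₂) * d) ((δ₂ * n₁) * c)) ∧
          (Nat.Coprime n₁ n₂ ∧ n₁ ≡ n₂ [MOD q₀] ∧ (n₀ * n₁).Coprime q₀ ∧ (n₀ * n₂).Coprime q₀ ∧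
            ((nlo : ℕ) : ℤ) ≤ nVar 1 a₁ a₂ q₀ h n₁ n₂ ∧ nVar 1 a₁ a₂ q₀ h n₁ n₂ < ((nhi : ℕ) : ℤ))) then
            (β (n₀ * n₁) * starRingEnd ℂ (β (n₀ * n₂)) *
              ((𝐞 (-(ξ * h)) : ℂ) *
                (𝐞 (-((h : ℝ) * a₁ *
                    ((((((q₀ : ℤ) * l₁ * l₂ * n₁ : ℤ) : ZMod (a₂.natAbs * n₀))⁻¹).val : ℕ) : ℝ) /
                      ((a₂ : ℝ) * n₀))) : ℂ))) *
            (g c d (nVar 1 a₁ a₂ q₀ h n₁ n₂).toNat ((a₂.natAbs * n₀ * δ₁ * n₂ : ℕ) : ℝ) ((δ₂ * n₁ : ℕ) : ℝ) *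
              (𝐞 (((nVar 1 a₁ a₂ q₀ h n₁ n₂).toNat : ℝ) * (((((a₂.natAbs * n₀ * δ₁ * n₂) * d : ℕ) : ZMod ((δ₂ * n₁) * c))⁻¹).val : ℝ) /
                (((δ₂ * n₁ : ℕ) : ℝ) * c)) : ℂ))
          else 0) := by
    intro c hc d hd
    obtain ⟨hc0, hcm, hccls⟩ := moduli_facts hq₀ hl₂ hl₂lt hδ₂ hδ₂m hc₀ hc
    obtain ⟨_, hdm, hdcls⟩ := moduli_facts hq₀ hl₁ hl₁lt hδ₁ hδ₁m hd₀ hd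
    exact inner_match_pos ha₂ hq₀n₀ hδ₁m hδ₂m hc0 hcm hdm ⟨hccls, hdcls⟩ hB hβ hδ₂ hIn hIr hIs
      (hGg c d)
  rw [Finset.sum_congr rfl fun c hc => Finset.sum_congr rfl fun d hd => hleft c hc d hd]
  exact sum_sum_eq_of_support _ _ _ _ _ fun c d h =>
    collInner_support hN ha₂ hq₀ hn₀ hq₀a₂ hl₁ hl₂ hl₁lt hl₂lt hδ₁ hδ₂ hc₀ hd₀ H nlo nhi Cn Dn
      hgsupp 1 _ c d h

/-- **The negative block: its conjugate is a left-hand side of Theorem 2.1** (coefficients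
`bGen … (conj ∘ value)`; the weight `G` is real). [cite: Drappeau2017, §5.5 p. 20–21, Theorem 2.1] -/
theorem conj_pieceSumBlk_eq_cruxLHS_neg {S Y N : ℝ} (hN : 0 ≤ N) {a₁ a₂ : ℤ} (ha₂ : a₂ ≠ 0) {q₀ n₀ : ℕ}
    (hq₀ : 0 < q₀) (hn₀ : 0 < n₀) (hq₀n₀ : Nat.Coprime q₀ n₀) (hq₀a₂ : IsCoprime (q₀ : ℤ) a₂)
    {l₁ l₂ : ℕ} (hl₁ : Nat.Coprime l₁ (a₂.natAbs * n₀)) (hl₂ : Nat.Coprime l₂ (a₂.natAbs * n₀))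
    (hl₁lt : l₁ < a₂.natAbs * n₀) (hl₂lt : l₂ < a₂.natAbs * n₀)
    {δ₁ δ₂ : ℕ} (hδ₁ : 0 < δ₁) (hδ₂ : 0 < δ₂) (hδ₁m : Nat.Coprime δ₁ (a₂.natAbs * n₀))
    (hδ₂m : Nat.Coprime δ₂ (a₂.natAbs * n₀)) {c₀ d₀ : ℕ}
    (hc₀ : δ₂ * c₀ ≡ l₂ [MOD a₂.natAbs * n₀]) (hd₀ : δ₁ * d₀ ≡ l₁ [MOD a₂.natAbs * n₀])
    {β : ℕ → ℂ} (hβ : ∀ n, ¬Squarefree n → β n = 0) (ξ : ℝ) (H nlo nhi Cn Dn : ℕ)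
    {In Ir Is : Finset ℕ}
    (hIn : ∀ z : ℤ, ((nlo : ℕ) : ℤ) ≤ z → z < ((nhi : ℕ) : ℤ) → z.toNat ∈ In)
    (hIr : ∀ n₂ ∈ ((((BFI.dyadic N).filter (fun n : ℕ => IsCoprime (n : ℤ) a₂)).filter (fun n : ℕ => n₀ ∣ n)).image (fun n : ℕ => n / n₀)), a₂.natAbs * n₀ * δ₁ * n₂ ∈ Ir)
    (hIs : ∀ n₁ ∈ ((((BFI.dyadic N).filter (fun n : ℕ => IsCoprime (n : ℤ) a₂)).filter (fun n : ℕ => n₀ ∣ n)).image (fun n : ℕ => n / n₀)), δ₂ * n₁ ∈ Is)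
    {G : ℕ → ℕ → ℂ} {g : ℝ → ℝ → ℝ → ℝ → ℝ → ℂ}
    (hgsupp : ∀ c d : ℕ, ∀ n r s : ℝ, g c d n r s ≠ 0 →
      (1 ≤ c ∧ c ≤ Cn ∧ 1 ≤ d ∧ d ≤ Dn) ∧ q₀ * (δ₂ * c) ∈ BFI.mRange S Y ∧
        q₀ * (δ₁ * d) ∈ BFI.mRange S Y)
    (hGreal : ∀ q₁ q₂ : ℕ, starRingEnd ℂ (G q₁ q₂) = G q₁ q₂)
    (hGg : ∀ c d : ℕ, ∀ n₁ ∈ ((((BFI.dyadic N).filter (fun n : ℕ => IsCoprime (n : ℤ) a₂)).filter (fun n : ℕ => n₀ ∣ n)).image (fun n : ℕ => n / n₀)), ∀ n₂ ∈ ((((BFI.dyadic N).filter (fun n : ℕ => IsCoprime (n : ℤ) a₂)).filter (fun n : ℕ => n₀ ∣ n)).image (fun n : ℕ => n / n₀)), ∀ h : ℤ,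
      ((nlo : ℕ) : ℤ) ≤ nVar (-1) a₁ a₂ q₀ h n₁ n₂ → nVar (-1) a₁ a₂ q₀ h n₁ n₂ < ((nhi : ℕ) : ℤ) →
      G (δ₁ * d) (δ₂ * c) = g c d (nVar (-1) a₁ a₂ q₀ h n₁ n₂).toNat ((a₂.natAbs * n₀ * δ₁ * n₂ : ℕ) : ℝ) ((δ₂ * n₁ : ℕ) : ℝ)) :
    starRingEnd ℂ (pieceSumBlk a₁ a₂ (((((((BFI.mRange S Y).filter (fun q : ℕ => 0 < q)).filter (fun q : ℕ => IsCoprime (q : ℤ) a₂)).filter (fun q : ℕ => q₀ ∣ q)).image (fun q : ℕ => q / q₀)).filter (fun q : ℕ => q % (a₂.natAbs * n₀) = l₁)).filter (fun q : ℕ => δ₁ ∣ q))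
        (((((((BFI.mRange S Y).filter (fun q : ℕ => 0 < q)).filter (fun q : ℕ => IsCoprime (q : ℤ) a₂)).filter (fun q : ℕ => q₀ ∣ q)).image (fun q : ℕ => q / q₀)).filter (fun q : ℕ => q % (a₂.natAbs * n₀) = l₂)).filter (fun q : ℕ => δ₂ ∣ q)) ((((BFI.dyadic N).filter (fun n : ℕ => IsCoprime (n : ℤ) a₂)).filter (fun n : ℕ => n₀ ∣ n)).image (fun n : ℕ => n / n₀))
        q₀ n₀ l₁ l₂ β ξ G H (-1) nlo nhi) =
      ∑ c ∈ Finset.Icc 1 Cn, ∑ d ∈ Finset.Icc 1 Dn, ∑ n ∈ In, ∑ r ∈ Ir, ∑ s ∈ Is,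
        (if (c ≡ c₀ [MOD a₂.natAbs * n₀] ∧ d ≡ d₀ [MOD a₂.natAbs * n₀] ∧
            Nat.Coprime (a₂.natAbs * n₀ * r * d) (s * c)) then
          (bGen a₁ a₂ ((((BFI.dyadic N).filter (fun n : ℕ => IsCoprime (n : ℤ) a₂)).filter (fun n : ℕ => n₀ ∣ n)).image (fun n : ℕ => n / n₀)) q₀ n₀ H (-1) nlo nhi δ₁ δ₂
            (fun h n₁ n₂ => starRingEnd ℂ (β (n₀ * n₁) * starRingEnd ℂ (β (n₀ * n₂)) *
              ((𝐞 (-(ξ * h)) : ℂ) *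
                (𝐞 (-((h : ℝ) * a₁ *
                    ((((((q₀ : ℤ) * l₁ * l₂ * n₁ : ℤ) : ZMod (a₂.natAbs * n₀))⁻¹).val : ℕ) : ℝ) /
                      ((a₂ : ℝ) * n₀))) : ℂ))))) n r s * g c d n r s *
            (𝐞 ((n : ℝ) * ((((r * d : ℕ) : ZMod (s * c))⁻¹).val : ℝ) / ((s : ℝ) * c)) : ℂ)
        else 0) := by
  have hre : ∑ c ∈ Finset.Icc 1 Cn, ∑ d ∈ Finset.Icc 1 Dn, ∑ n ∈ In, ∑ r ∈ Ir, ∑ s ∈ Is,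
        (if (c ≡ c₀ [MOD a₂.natAbs * n₀] ∧ d ≡ d₀ [MOD a₂.natAbs * n₀] ∧
            Nat.Coprime (a₂.natAbs * n₀ * r * d) (s * c)) then
          (bGen a₁ a₂ ((((BFI.dyadic N).filter (fun n : ℕ => IsCoprime (n : ℤ) a₂)).filter (fun n : ℕ => n₀ ∣ n)).image (fun n : ℕ => n / n₀)) q₀ n₀ H (-1) nlo nhi δ₁ δ₂
            (fun h n₁ n₂ => starRingEnd ℂ (β (n₀ * n₁) * starRingEnd ℂ (β (n₀ * n₂)) *
              ((𝐞 (-(ξ * h)) : ℂ) *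
                (𝐞 (-((h : ℝ) * a₁ *
                    ((((((q₀ : ℤ) * l₁ * l₂ * n₁ : ℤ) : ZMod (a₂.natAbs * n₀))⁻¹).val : ℕ) : ℝ) /
                      ((a₂ : ℝ) * n₀))) : ℂ))))) n r s * g c d n r s *
            (𝐞 ((n : ℝ) * ((((r * d : ℕ) : ZMod (s * c))⁻¹).val : ℝ) / ((s : ℝ) * c)) : ℂ)
        else 0) =
      ∑ c ∈ Finset.Icc 1 Cn, ∑ d ∈ Finset.Icc 1 Dn, ∑ n ∈ In, ∑ r ∈ Ir, ∑ s ∈ Is,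
        (if (c ≡ c₀ [MOD a₂.natAbs * n₀] ∧ d ≡ d₀ [MOD a₂.natAbs * n₀] ∧
            Nat.Coprime (a₂.natAbs * n₀ * r * d) (s * c)) then
          bGen a₁ a₂ ((((BFI.dyadic N).filter (fun n : ℕ => IsCoprime (n : ℤ) a₂)).filter (fun n : ℕ => n₀ ∣ n)).image (fun n : ℕ => n / n₀)) q₀ n₀ H (-1) nlo nhi δ₁ δ₂
            (fun h n₁ n₂ => starRingEnd ℂ (β (n₀ * n₁) * starRingEnd ℂ (β (n₀ * n₂)) *
              ((𝐞 (-(ξ * h)) : ℂ) *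
                (𝐞 (-((h : ℝ) * a₁ *
                    ((((((q₀ : ℤ) * l₁ * l₂ * n₁ : ℤ) : ZMod (a₂.natAbs * n₀))⁻¹).val : ℕ) : ℝ) /
                      ((a₂ : ℝ) * n₀))) : ℂ)))) n r s *
            (fun c d n r s : ℕ => g c d n r s *
              (𝐞 ((n : ℝ) * ((((r * d : ℕ) : ZMod (s * c))⁻¹).val : ℝ) / ((s : ℝ) * c)) : ℂ))
              c d n r s
        else 0) := by
    refine Finset.sum_congr rfl fun c _ => Finset.sum_congr rfl fun d _ =>
      Finset.sum_congr rfl fun n _ => Finset.sum_congr rfl fun r _ =>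
      Finset.sum_congr rfl fun s _ => ?_
    split_ifs
    · exact mul_assoc _ _ _
    · rfl
  rw [hre, cruxSum_bGen_eq]
  rw [pieceSumBlk_reindex, map_sum]
  simp_rw [map_sum (starRingEnd ℂ) _ ((((((((BFI.mRange S Y).filter (fun q : ℕ => 0 < q)).filter (fun q : ℕ => IsCoprime (q : ℤ) a₂)).filter (fun q : ℕ => q₀ ∣ q)).image (fun q : ℕ => q / q₀)).filter (fun q : ℕ => q % (a₂.natAbs * n₀) = l₂)).filter (fun q : ℕ => δ₂ ∣ q)).image (fun q : ℕ => q / δ₂))]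
  rw [Finset.sum_comm]
  have hB : ∀ n ∈ ((((BFI.dyadic N).filter (fun n : ℕ => IsCoprime (n : ℤ) a₂)).filter (fun n : ℕ => n₀ ∣ n)).image (fun n : ℕ => n / n₀)), 0 < n ∧ Nat.Coprime (n₀ * n) a₂.natAbs :=
    fun n hn => ⟨(mem_Bset hN hn₀ hn).1, (mem_Bset hN hn₀ hn).2.1⟩
  have hleft : ∀ c ∈ ((((((((BFI.mRange S Y).filter (fun q : ℕ => 0 < q)).filter (fun q : ℕ => IsCoprime (q : ℤ) a₂)).filter (fun q : ℕ => q₀ ∣ q)).image (fun q : ℕ => q / q₀)).filter (fun q : ℕ => q % (a₂.natAbs * n₀) = l₂)).filter (fun q : ℕ => δ₂ ∣ q)).image (fun q : ℕ => q / δ₂)), ∀ d ∈ ((((((((BFI.mRange S Y).filter (fun q : ℕ => 0 < q)).filter (fun q : ℕ => IsCoprime (q : ℤ) a₂)).filter (fun q : ℕ => q₀ ∣ q)).image (fun q : ℕ => q / q₀)).filter (fun q : ℕ => q % (a₂.natAbs * n₀) = l₁)).filter (fun q : ℕ => δ₁ ∣ q)).image (fun q : ℕ => q / δ₁)),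
      starRingEnd ℂ (∑ n₁ ∈ ((((BFI.dyadic N).filter (fun n : ℕ => IsCoprime (n : ℤ) a₂)).filter (fun n : ℕ => n₀ ∣ n)).image (fun n : ℕ => n / n₀)), ∑ n₂ ∈ ((((BFI.dyadic N).filter (fun n : ℕ => IsCoprime (n : ℤ) a₂)).filter (fun n : ℕ => n₀ ∣ n)).image (fun n : ℕ => n / n₀)), ∑ h ∈ (Finset.Icc (-(H : ℤ)) H).filter (fun h : ℤ => h ≠ 0),
          (if ((Nat.Coprime (δ₁ * d) (δ₂ * c) ∧ Nat.Coprime n₁ n₂ ∧ ((n₀ * n₁).Coprime (q₀ * (δ₁ * d)) ∧ (n₀ * n₂).Coprime (q₀ * (δ₂ * c)) ∧ n₁ ≡ n₂ [MOD q₀])) ∧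
          (((nlo : ℕ) : ℤ) ≤ nVar (-1) a₁ a₂ q₀ h n₁ n₂ ∧ nVar (-1) a₁ a₂ q₀ h n₁ n₂ < ((nhi : ℕ) : ℤ))) then
            G (δ₁ * d) (δ₂ * c) * (β (n₀ * n₁) * starRingEnd ℂ (β (n₀ * n₂))) *
              ((𝐞 (-(ξ * h)) : ℂ) *
                ((𝐞 ((h : ℝ) * a₁ * ((((n₁ : ℤ) - n₂) / q₀ : ℤ)) *
                    (((((((δ₁ * d : ℕ) : ℤ) * a₂ * n₀ * n₂ : ℤ) : ZMod (n₁ * (δ₂ * c)))⁻¹).val : ℕ) : ℝ) /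
                      ((n₁ : ℝ) * ((δ₂ * c : ℕ) : ℝ))) : ℂ) *
                  (𝐞 (-((h : ℝ) * a₁ *
                    ((((((q₀ : ℤ) * l₁ * l₂ * n₁ : ℤ) : ZMod (a₂.natAbs * n₀))⁻¹).val : ℕ) : ℝ) /
                      ((a₂ : ℝ) * n₀))) : ℂ)))
      else 0)) = ∑ n₁ ∈ ((((BFI.dyadic N).filter (fun n : ℕ => IsCoprime (n : ℤ) a₂)).filter (fun n : ℕ => n₀ ∣ n)).image (fun n : ℕ => n / n₀)), ∑ n₂ ∈ ((((BFI.dyadic N).filter (fun n : ℕ => IsCoprime (n : ℤ) a₂)).filter (fun n : ℕ => n₀ ∣ n)).image (fun n : ℕ => n / n₀)), ∑ h ∈ (Finset.Icc (-(H : ℤ)) H).filter (fun h : ℤ => h ≠ 0),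
          (if (0 ≤ nVar (-1) a₁ a₂ q₀ h n₁ n₂ ∧ (nVar (-1) a₁ a₂ q₀ h n₁ n₂).toNat ∈ In ∧ (a₂.natAbs * n₀ * δ₁ * n₂) ∈ Ir ∧ (δ₂ * n₁) ∈ Is ∧
          (c ≡ c₀ [MOD a₂.natAbs * n₀] ∧ d ≡ d₀ [MOD a₂.natAbs * n₀] ∧ Nat.Coprime (a₂.natAbs * n₀ * (a₂.natAbs * n₀ * δ₁ * n₂) * d) ((δ₂ * n₁) * c)) ∧
          (Nat.Coprime n₁ n₂ ∧ n₁ ≡ n₂ [MOD q₀] ∧ (n₀ * n₁).Coprime q₀ ∧ (n₀ * n₂).Coprime q₀ ∧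
            ((nlo : ℕ) : ℤ) ≤ nVar (-1) a₁ a₂ q₀ h n₁ n₂ ∧ nVar (-1) a₁ a₂ q₀ h n₁ n₂ < ((nhi : ℕ) : ℤ))) then
            starRingEnd ℂ (β (n₀ * n₁) * starRingEnd ℂ (β (n₀ * n₂)) *
              ((𝐞 (-(ξ * h)) : ℂ) *
                (𝐞 (-((h : ℝ) * a₁ *
                    ((((((q₀ : ℤ) * l₁ * l₂ * n₁ : ℤ) : ZMod (a₂.natAbs * n₀))⁻¹).val : ℕ) : ℝ) /
                      ((a₂ : ℝ) * n₀))) : ℂ))) *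
            (g c d (nVar (-1) a₁ a₂ q₀ h n₁ n₂).toNat ((a₂.natAbs * n₀ * δ₁ * n₂ : ℕ) : ℝ) ((δ₂ * n₁ : ℕ) : ℝ) *
              (𝐞 (((nVar (-1) a₁ a₂ q₀ h n₁ n₂).toNat : ℝ) * (((((a₂.natAbs * n₀ * δ₁ * n₂) * d : ℕ) : ZMod ((δ₂ * n₁) * c))⁻¹).val : ℝ) /
                (((δ₂ * n₁ : ℕ) : ℝ) * c)) : ℂ))
          else 0) := by
    intro c hc d hd
    obtain ⟨hc0, hcm, hccls⟩ := moduli_facts hq₀ hl₂ hl₂lt hδ₂ hδ₂m hc₀ hc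
    obtain ⟨_, hdm, hdcls⟩ := moduli_facts hq₀ hl₁ hl₁lt hδ₁ hδ₁m hd₀ hd
    exact inner_match_neg ha₂ hq₀n₀ hδ₁m hδ₂m hc0 hcm hdm ⟨hccls, hdcls⟩ hB hβ hδ₂ hIn hIr hIs
      (hGreal _ _) (hGg c d)
  rw [Finset.sum_congr rfl fun c hc => Finset.sum_congr rfl fun d hd => hleft c hc d hd]
  exact sum_sum_eq_of_support _ _ _ _ _ fun c d h =>
    collInner_support hN ha₂ hq₀ hn₀ hq₀a₂ hl₁ hl₂ hl₁lt hl₂lt hδ₁ hδ₂ hc₀ hd₀ H nlo nhi Cn Dn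
      hgsupp (-1) _ c d h

end Main

end Drappeau2017

end Literature.NumberTheory.Sieve

end
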